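import Summits.NavierStokesRegularity.NavierStokesRegularity.Theorems.CompletionRelayChainRelayTable
import Summits.NavierStokesRegularity.NavierStokesRegularity.Theorems.CompletionRelayChainRelayFrontStep
import Summits.NavierStokesRegularity.NavierStokesRegularity.Theorems.CompletionRelayChainRestartControl
import Summits.NavierStokesRegularity.NavierStokesRegularity.Theorems.CompletionRelayChainRestartGlue
import Summits.NavierStokesRegularity.NavierStokesRegularity.Theorems.CompletionRelayChainLocalDynamicsSufficesAt
import HarnessLib

/-!
# Rung TL-M3-R64 `TargetR64` from the completed route CompletionRelayChain

Closes the leaf item `stmt-NavierStokesRegularity-24294`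
(`Summit.NavierStokesRegularity.NavierStokesRegularity.Theses.TaoLadderRungThree.TargetR64`, the rung of
record TL-M3-R64 of the Tao-ladder, D-0061) by applying the deciding theorem
`Theses.CompletionRelayChain.closes` of route `CompletionRelayChain` to its five landed item proofs:

* `RelayTable` (stmt-24851) — `Theorems.completionRelayChain_relayTable_proof`;
* `RelayFrontStep` (stmt-24850) — `Cruxes.RelayFrontStep.Window2.RelayFrontStep_of`
  (line `window_v2`: `stub_phaseI` = kernel-replayed validated Taylor-model certificate, `stub_ignition`);
* `RestartControl` (stmt-24852), `RestartGlue` (stmt-24853), `LocalDynamicsSufficesAt` (stmt-24854) —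
  `Theorems.completionRelayChain_{restartControl,restartGlue,localDynamicsSufficesAt}_proof`.

COMPUTATIONAL CONE: through `RelayFrontStep_of` the proof depends on the `native_decide` auxiliary axioms of
the 41 certificate data modules `…Theorems.CompletionRelayChainPhaseIRun00` … `Run40` (gate-verified,
computational lane), besides `propext`, `Classical.choice`, `Quot.sound`.

MODEL statement only (Tao's averaged dyadic cascade at spread 64): a 64-comparable symmetric cancelling
four-mode table with a one-shell datum exhibiting `NoGlobalCascade` at scale ratio 2. NOTHING here is a
statement about the Navier–Stokes equations.
-/

set_option linter.dupNamespace false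

namespace Summit.NavierStokesRegularity.NavierStokesRegularity.Theorems

/-- **TL-M3-R64 (MODEL rung of record).** There are a 64-comparable symmetric cancelling four-mode
coefficient table `α` on Tao's topology and one-shell datum amplitudes `X₀` with
`TaoCascade.NoGlobalCascade 1 α X₀` — the leaf `TaoLadderRungThree.TargetR64` BY NAME, obtained from the
deciding theorem of route `CompletionRelayChain` and its five landed items (computational cone, see the
module docstring). A statement about Tao's model cascade, not about Navier–Stokes. -/
theorem taoLadderRungThree_targetR64_proof :
    Summit.NavierStokesRegularity.NavierStokesRegularity.Theses.TaoLadderRungThree.TargetR64 :=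
  Summit.NavierStokesRegularity.NavierStokesRegularity.Theses.CompletionRelayChain.closes
    completionRelayChain_relayTable_proof
    Summit.NavierStokesRegularity.NavierStokesRegularity.Cruxes.RelayFrontStep.Window2.RelayFrontStep_of
    completionRelayChain_restartControl_proof
    completionRelayChain_restartGlue_proof
    completionRelayChain_localDynamicsSufficesAt_proof

end Summit.NavierStokesRegularity.NavierStokesRegularity.Theorems
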